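import Literature.NumberTheory.GaloisRepresentations.PontryaginTateDualInverseLimitScalars
import Literature.NumberTheory.GaloisRepresentations.ContinuousShapiroOpenCoinducedDescent
import HarnessLib

/-!
# The compact Tate dual `T* = lim_k Hom(D_k, μ_{p^k})`, IV: the scalars `θ̂` commute with the
# comparison `H¹_cont(Γ, T*) ≃ lim_k H¹(Γ, Hom(D_k, μ_{p^k}))` (levelwise `θ̂_k`)

Topic `NumberTheory/GaloisRepresentations`; sequel of `PontryaginTateDualInverseLimitScalars.lean`
(namespace `Literature.NumberTheory.GaloisRepresentations.DiscreteGaloisModule.TorsionLayers`).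
Definitions WITH BODIES and theorems; no named fact, no `sorry`, no instance, no notation. Seat
`bsd-line-x1-p1-w4` gen 18 (prover, width seat of cell `bsd-eis`), brick C2 (ii) of the road memo
«SUR-Λ» (crux `GoodLatticeBDPValue`, stmt-BirchSwinnertonDyer-19032; consumer: brick C5a-II's
adjunction `⟪θ_* t, y⟫_v = ⟪t, θ̂_* y⟫_v` for the Λ-adic local pairing).

MATHEMATICS (R. Greenberg, Kyoto J. Math. 50 (2010), §2 p. 6 L5–8: the `Λ`-module structure of
`T* = Hom(D, μ_{p^∞})`, `(θ·x)(d) = x(θ d)`, and of its cohomology): the endomorphism `θ̂` of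
`T* = lim_k Hom(D_k, μ_{p^k})` induced by a layer-preserving `Γ_K`-equivariant additive `θ : D → D`
(part II, `dualEndHom`) is the limit of the levelwise endomorphisms `θ̂_k : f ↦ f ∘ θ` of
`Hom(D_k, μ_{p^k})`; hence on cohomology `Hⁿ(proj_k) ∘ Hⁿ(θ̂) = Hⁿ(θ̂_k) ∘ Hⁿ(proj_k)`, globally and
along any `φ : H →ₜ* Γ_K` (e.g. the decomposition groups).

* `E.layerDualEndHom θ hθ hθτ k : Hom(D_k, μ_{p^k}) ⟶ Hom(D_k, μ_{p^k})` in `TopRep` (`θ̂_k`), with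
  `layerDualEnd_layerDualRep` (equivariance), `layerDualEnd_dualRes` (compatibility with transitions),
  `projHom_dualEndHom_apply` (`proj_k ∘ θ̂ = θ̂_k ∘ proj_k`, `rfl`);
* **`cohomologyMap_projHom_dualEndHom`** (all degrees) and its coordinate form
  `continuousCohomologyOneEquiv_cohomologyMap_dualEndHom` for the degree-`1` comparison of part II;
* the same along `φ : H →ₜ* Γ_K` for the restricted system `E.dualSystem.comap φ`:
  `layerDualEndHomComap`, `dualEndHomComap'` (= part III's `dualEndHomComap`, restated here so that
  this file depends on part II only), **`cohomologyMap_projHom_dualEndHomComap`**,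
  `continuousCohomologyOneEquivComap_cohomologyMap_dualEndHomComap`.

HONESTY. Infrastructure only; nothing here proves a statement of Greenberg's papers or any summit
statement; BSD is not advanced. AI-typed, kernel-checked.

## References
* R. Greenberg, *Surjectivity of the global-to-local map defining a Selmer group*, Kyoto J. Math. 50
  (2010) 853–888, §2 p. 6 L5–8, (7)–(8) pp. 7–8. [Greenberg2010]
* J. Neukirch, A. Schmidt, K. Wingberg, *Cohomology of Number Fields*, 2nd ed. (2008), II §7
  Thm. (2.7.5). [NeukirchSchmidtWingberg2008]
-/

noncomputable section

open Function CategoryTheory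
open _root_.TopRep _root_.ContRepresentation _root_.ContinuousCohomology
open Literature.NumberTheory.GaloisRepresentations.DiscreteGaloisModule

namespace Literature.NumberTheory.GaloisRepresentations

variable {K : Type} [Field K] {D : Type} [AddCommGroup D] [TopologicalSpace D] [DiscreteTopology D]

namespace DiscreteGaloisModule.TorsionLayers

variable {τ : DiscreteGaloisModule K D} {p : ℕ} (E : τ.TorsionLayers p)
  (θ : D →+ D) (hθ : ∀ (k : ℕ), ∀ d ∈ E.N k, θ d ∈ E.N k)

/-! ### The levelwise endomorphisms `θ̂_k` of `Hom(D_k, μ_{p^k})` -/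

/-- `θ` commutes with `Γ_K` on the layer `D_k`. [cite: Greenberg2010, §2 p. 6 L5–8] -/
theorem layerEnd_layerRep (hθτ : ∀ (σ : Field.absoluteGaloisGroup K) (d : D), θ (τ σ d) = τ σ (θ d)) (k : ℕ) (σ : Field.absoluteGaloisGroup K) (x : E.N k) :
    E.layerEnd θ hθ k (E.layerRep k σ x) = E.layerRep k σ (E.layerEnd θ hθ k x) :=
  Subtype.ext (hθτ σ x)

/-- **`θ̂_k` is `Γ_K`-equivariant**: `(σ f) ∘ θ = σ (f ∘ θ)` on `Hom(D_k, μ_{p^k})`.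
[cite: Greenberg2010, §2 p. 6 L5–8] -/
theorem layerDualEnd_layerDualRep (hθτ : ∀ (σ : Field.absoluteGaloisGroup K) (d : D), θ (τ σ d) = τ σ (θ d))
    (k : ℕ) (σ : Field.absoluteGaloisGroup K) (f : E.LayerDual k) :
    E.layerDualEnd θ hθ k (E.layerDualRep k σ f) = E.layerDualRep k σ (E.layerDualEnd θ hθ k f) :=
  E.ext_uval fun x => by
    rw [uval_layerDualEnd, uval_layerDualRep, uval_layerDualRep, uval_layerDualEnd,
      E.layerEnd_layerRep θ hθ hθτ k σ⁻¹ x]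

/-- **`θ̂_k` commutes with the transition maps**: `(res f) ∘ θ = res (f ∘ θ)`.
[cite: Greenberg2010, §2 p. 6 L5–8] -/
theorem layerDualEnd_dualRes {n m : ℕ} (h : n ≤ m) (f : E.LayerDual m) :
    E.layerDualEnd θ hθ n (E.dualRes h f) = E.dualRes h (E.layerDualEnd θ hθ m f) :=
  E.ext_uval fun x => by
    rw [uval_layerDualEnd, uval_dualRes, uval_dualRes, uval_layerDualEnd]
    rfl

/-- **`θ̂_k : Hom(D_k, μ_{p^k}) ⟶ Hom(D_k, μ_{p^k})`** in `TopRep` (`f ↦ f ∘ θ`), for `θ` commuting with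
`Γ_K`. [cite: Greenberg2010, §2 p. 6 L5–8] -/
def layerDualEndHom (hθτ : ∀ (σ : Field.absoluteGaloisGroup K) (d : D), θ (τ σ d) = τ σ (θ d)) (k : ℕ) :
    (E.layerDualRep k).toTopRep ⟶ (E.layerDualRep k).toTopRep :=
  TopRep.ofHom ⟨⟨(E.layerDualEnd θ hθ k).toIntLinearMap, continuous_of_discreteTopology⟩, fun σ =>
    ContinuousLinearMap.ext fun f => by exact E.layerDualEnd_layerDualRep θ hθ hθτ k σ f⟩

/-- Unfolding `layerDualEndHom`. [cite: Greenberg2010, §2 p. 6 L5–8] -/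
@[simp] theorem layerDualEndHom_hom_apply (hθτ : ∀ (σ : Field.absoluteGaloisGroup K) (d : D), θ (τ σ d) = τ σ (θ d)) (k : ℕ) (f : E.LayerDual k) :
    (E.layerDualEndHom θ hθ hθτ k).hom f = E.layerDualEnd θ hθ k f := rfl

/-- **`proj_k ∘ θ̂ = θ̂_k ∘ proj_k`** on `T*` (elements). [cite: Greenberg2010, §2 p. 6 L5–8] -/
theorem projHom_dualEndHom_apply (hθτ : ∀ (σ : Field.absoluteGaloisGroup K) (d : D), θ (τ σ d) = τ σ (θ d)) (k : ℕ) (x : E.dualSystem.limit) :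
    (E.dualSystem.projHom k).hom ((E.dualEndHom θ hθ hθτ).hom x) =
      (E.layerDualEndHom θ hθ hθτ k).hom ((E.dualSystem.projHom k).hom x) := rfl

/-! ### `Hⁿ(proj_k) ∘ Hⁿ(θ̂) = Hⁿ(θ̂_k) ∘ Hⁿ(proj_k)` -/

section Global

variable [IsTopologicalGroup (Field.absoluteGaloisGroup K)]

/-- **`Hⁿ(proj_k) ∘ Hⁿ(θ̂) = Hⁿ(θ̂_k) ∘ Hⁿ(proj_k)`** on `Hⁿ_cont(Γ_K, T*)` (both composites are `Hⁿ`
of the same morphism `T* → Hom(D_k, μ_{p^k})`). [cite: Greenberg2010, §2 p. 6 L5–8, (7) p. 7] -/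
theorem cohomologyMap_projHom_dualEndHom (hθτ : ∀ (σ : Field.absoluteGaloisGroup K) (d : D), θ (τ σ d) = τ σ (θ d)) (k n : ℕ)
    (y : continuousCohomology n E.dualSystem.limitRep.toTopRep) :
    cohomologyMap (E.dualSystem.projHom k) n (cohomologyMap (E.dualEndHom θ hθ hθτ) n y) =
      cohomologyMap (E.layerDualEndHom θ hθ hθτ k) n (cohomologyMap (E.dualSystem.projHom k) n y) :=
  (cohomologyMap_comp_apply_of_eq (E.dualEndHom θ hθ hθτ) (E.dualSystem.projHom k)
      (E.dualEndHom θ hθ hθτ ≫ E.dualSystem.projHom k) (fun _ => rfl) n y).trans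
    (cohomologyMap_comp_apply_of_eq (C := (E.dualSystem.ρ k).toTopRep) (E.dualSystem.projHom k)
      (E.layerDualEndHom θ hθ hθτ k) (E.dualEndHom θ hθ hθτ ≫ E.dualSystem.projHom k)
      (fun _ => rfl) n y).symm

/-- **The degree-`1` comparison `H¹_cont(Γ_K, T*) ≃ lim_k H¹(Γ_K, Hom(D_k, μ_{p^k}))` commutes with
`θ̂`** (coordinatewise `θ̂_k`). [cite: Greenberg2010, §2 p. 6 L5–8] [cite: NeukirchSchmidtWingberg2008, II §7 Thm 2.7.5] -/
theorem continuousCohomologyOneEquiv_cohomologyMap_dualEndHom (hθτ : ∀ (σ : Field.absoluteGaloisGroup K) (d : D), θ (τ σ d) = τ σ (θ d)) [NeZero p]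
    (y : continuousCohomology 1 E.dualSystem.limitRep.toTopRep) (k : ℕ) :
    (E.continuousCohomologyOneEquiv (cohomologyMap (E.dualEndHom θ hθ hθτ) 1 y) :
        ∀ k, continuousCohomology 1 (E.dualSystem.ρ k).toTopRep) k =
      cohomologyMap (E.layerDualEndHom θ hθ hθτ k) 1
        ((E.continuousCohomologyOneEquiv y : ∀ k, continuousCohomology 1 (E.dualSystem.ρ k).toTopRep) k) :=
  E.cohomologyMap_projHom_dualEndHom θ hθ hθτ k 1 y

end Global

/-! ### The same along `φ : H →ₜ* Γ_K` (the restricted system `E.dualSystem.comap φ`) -/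

section Comap

variable {H : Type} [Group H] [TopologicalSpace H] [IsTopologicalGroup H]

/-- **`θ̂_k` on the restricted level `Hom(D_k, μ_{p^k})|_H`** in `TopRep`. [cite: Greenberg2010, §2 p. 6 L5–8, (8) p. 8] -/
def layerDualEndHomComap (hθτ : ∀ (σ : Field.absoluteGaloisGroup K) (d : D), θ (τ σ d) = τ σ (θ d)) (φ : H →ₜ* Field.absoluteGaloisGroup K) (k : ℕ) :
    ((E.dualSystem.comap φ).ρ k).toTopRep ⟶ ((E.dualSystem.comap φ).ρ k).toTopRep :=
  TopRep.ofHom ⟨⟨(E.layerDualEnd θ hθ k).toIntLinearMap, continuous_of_discreteTopology⟩, fun h =>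
    ContinuousLinearMap.ext fun f => by exact E.layerDualEnd_layerDualRep θ hθ hθτ k (φ h) f⟩

omit [IsTopologicalGroup H] in
/-- Unfolding `layerDualEndHomComap`. [cite: Greenberg2010, §2 p. 6 L5–8] -/
@[simp] theorem layerDualEndHomComap_hom_apply (hθτ : ∀ (σ : Field.absoluteGaloisGroup K) (d : D), θ (τ σ d) = τ σ (θ d)) (φ : H →ₜ* Field.absoluteGaloisGroup K) (k : ℕ) (f : E.LayerDual k) :
    (E.layerDualEndHomComap θ hθ hθτ φ k).hom f = E.layerDualEnd θ hθ k f := rfl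

/-- **`θ̂` on the restricted `T*|_H`** in `TopRep` (the same map as part III's `dualEndHomComap`; restated
on part II's imports). [cite: Greenberg2010, §2 p. 6 L5–8, (8) p. 8] -/
def dualEndHomComap' (hθτ : ∀ (σ : Field.absoluteGaloisGroup K) (d : D), θ (τ σ d) = τ σ (θ d)) (φ : H →ₜ* Field.absoluteGaloisGroup K) :
    (E.dualSystem.comap φ).limitRep.toTopRep ⟶ (E.dualSystem.comap φ).limitRep.toTopRep :=
  TopRep.ofHom ⟨⟨(E.dualEnd θ hθ).toIntLinearMap, E.continuous_dualEnd θ hθ⟩, fun h =>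
    ContinuousLinearMap.ext fun x => by exact E.dualEnd_limitRep θ hθ hθτ (φ h) x⟩

omit [IsTopologicalGroup H] in
/-- Unfolding `dualEndHomComap'`. [cite: Greenberg2010, §2 p. 6 L5–8] -/
@[simp] theorem dualEndHomComap'_hom_apply (hθτ : ∀ (σ : Field.absoluteGaloisGroup K) (d : D), θ (τ σ d) = τ σ (θ d)) (φ : H →ₜ* Field.absoluteGaloisGroup K) (x : (E.dualSystem.comap φ).limit) :
    (E.dualEndHomComap' θ hθ hθτ φ).hom x = E.dualEnd θ hθ x := rfl

omit [IsTopologicalGroup H] in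
/-- `proj_k ∘ θ̂ = θ̂_k ∘ proj_k` on `T*|_H` (elements). [cite: Greenberg2010, §2 p. 6 L5–8] -/
theorem projHom_dualEndHomComap'_apply (hθτ : ∀ (σ : Field.absoluteGaloisGroup K) (d : D), θ (τ σ d) = τ σ (θ d)) (φ : H →ₜ* Field.absoluteGaloisGroup K) (k : ℕ) (x : (E.dualSystem.comap φ).limit) :
    ((E.dualSystem.comap φ).projHom k).hom ((E.dualEndHomComap' θ hθ hθτ φ).hom x) =
      (E.layerDualEndHomComap θ hθ hθτ φ k).hom (((E.dualSystem.comap φ).projHom k).hom x) := rfl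

/-- **`Hⁿ(proj_k) ∘ Hⁿ(θ̂) = Hⁿ(θ̂_k) ∘ Hⁿ(proj_k)` on `Hⁿ_cont(H, T*)`** (e.g. `H = Γ_{K_v}`), for ANY
`TopRep`-endomorphism `e` of `T*|_H` whose underlying map is `θ̂` (part III's `dualEndHomComap`, this
file's `dualEndHomComap'`, or `(resFunctor φ).map (E.dualEndHom …)` — all agree on elements).
[cite: Greenberg2010, §2 p. 6 L5–8, (8) p. 8] -/
theorem cohomologyMap_projHom_comap_of_hom_eq (hθτ : ∀ (σ : Field.absoluteGaloisGroup K) (d : D), θ (τ σ d) = τ σ (θ d)) (φ : H →ₜ* Field.absoluteGaloisGroup K) (k n : ℕ)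
    (e : (E.dualSystem.comap φ).limitRep.toTopRep ⟶ (E.dualSystem.comap φ).limitRep.toTopRep)
    (he : ∀ x, e.hom x = E.dualEnd θ hθ x)
    (y : continuousCohomology n (E.dualSystem.comap φ).limitRep.toTopRep) :
    cohomologyMap ((E.dualSystem.comap φ).projHom k) n (cohomologyMap e n y) =
      cohomologyMap (E.layerDualEndHomComap θ hθ hθτ φ k) n
        (cohomologyMap ((E.dualSystem.comap φ).projHom k) n y) :=
  (cohomologyMap_comp_apply_of_eq e ((E.dualSystem.comap φ).projHom k)
      (E.dualEndHomComap' θ hθ hθτ φ ≫ (E.dualSystem.comap φ).projHom k)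
      (fun x => by rw [he]; rfl) n y).trans
    (cohomologyMap_comp_apply_of_eq (C := ((E.dualSystem.comap φ).ρ k).toTopRep)
      ((E.dualSystem.comap φ).projHom k) (E.layerDualEndHomComap θ hθ hθτ φ k)
      (E.dualEndHomComap' θ hθ hθτ φ ≫ (E.dualSystem.comap φ).projHom k) (fun _ => rfl) n y).symm

/-- `Hⁿ(proj_k) ∘ Hⁿ(θ̂) = Hⁿ(θ̂_k) ∘ Hⁿ(proj_k)` on `Hⁿ_cont(H, T*)` for `dualEndHomComap'`.
[cite: Greenberg2010, §2 p. 6 L5–8, (8) p. 8] -/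
theorem cohomologyMap_projHom_dualEndHomComap' (hθτ : ∀ (σ : Field.absoluteGaloisGroup K) (d : D), θ (τ σ d) = τ σ (θ d)) (φ : H →ₜ* Field.absoluteGaloisGroup K) (k n : ℕ)
    (y : continuousCohomology n (E.dualSystem.comap φ).limitRep.toTopRep) :
    cohomologyMap ((E.dualSystem.comap φ).projHom k) n (cohomologyMap (E.dualEndHomComap' θ hθ hθτ φ) n y) =
      cohomologyMap (E.layerDualEndHomComap θ hθ hθτ φ k) n
        (cohomologyMap ((E.dualSystem.comap φ).projHom k) n y) :=
  E.cohomologyMap_projHom_comap_of_hom_eq θ hθ hθτ φ k n _ (fun _ => rfl) y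

/-- **The local degree-`1` comparison commutes with `θ̂`** (coordinatewise `θ̂_k`), for any
`TopRep`-endomorphism of `T*|_H` with underlying map `θ̂`.
[cite: Greenberg2010, §2 p. 6 L5–8] [cite: NeukirchSchmidtWingberg2008, II §7 Thm 2.7.5] -/
theorem continuousCohomologyOneEquivComap_cohomologyMap_of_hom_eq (hθτ : ∀ (σ : Field.absoluteGaloisGroup K) (d : D), θ (τ σ d) = τ σ (θ d)) (φ : H →ₜ* Field.absoluteGaloisGroup K) [NeZero p]
    (e : (E.dualSystem.comap φ).limitRep.toTopRep ⟶ (E.dualSystem.comap φ).limitRep.toTopRep)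
    (he : ∀ x, e.hom x = E.dualEnd θ hθ x)
    (y : continuousCohomology 1 (E.dualSystem.comap φ).limitRep.toTopRep) (k : ℕ) :
    (E.continuousCohomologyOneEquivComap φ (cohomologyMap e 1 y) :
        ∀ k, continuousCohomology 1 ((E.dualSystem.comap φ).ρ k).toTopRep) k =
      cohomologyMap (E.layerDualEndHomComap θ hθ hθτ φ k) 1
        ((E.continuousCohomologyOneEquivComap φ y :
          ∀ k, continuousCohomology 1 ((E.dualSystem.comap φ).ρ k).toTopRep) k) :=
  E.cohomologyMap_projHom_comap_of_hom_eq θ hθ hθτ φ k 1 e he y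

end Comap

end DiscreteGaloisModule.TorsionLayers

end Literature.NumberTheory.GaloisRepresentations

end
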